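import Summits.QuantumFields.BalabanUV.T4Continuum.Spine.NE1p.DressedComposedChainLetters

/-!
# T⁴ programme, spine estimate NE1′ (node O3b/H2) — THE LETTER SYSTEM OF THE COMPOSED (B3-count) CHAIN AT PRINT's BONDS-PER-CUBE
# LETTER: for EVERY bonds-per-cube letter `0 < b₀` — in particular the substrate's LOCATED `b₀ = 4·L^{4m′}` of S62 ∕ N1a PART 3
# (`card_bondsOfFineCubes_le_real`) — every `3 ≤ L` and every `0 ≤ r₁`, the located (B5)-KIND clauses of S51 ∕ S62 §1 (table pencil) AND
# of S57 ∕ S62 §2 (road P1's source pencil) are SIMULTANEOUSLY inhabited with EVERY letter live (`t = 1∕b₀`); and NECESSARILY the bond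
# letter PAYS the bonds-per-cube letter: `t ≤ (log((R_k − κ₀)∕(64s)) − 5R_k)∕b₀` — at the carriers of record `∕(4·L^{4m′})`;
# [arith] on OUR clause SHAPES — [Balaban1988RGII] pp. 12, 18–20 KIND only

Cell `pub-balaban`, sub-cell `t4`, BINDER-OWNERS row NE1′ (owner lineage t4-ne1p-p1, road P1 «RG-trajectory comparison»); crew seat
`b2b-balaban-t4-ne1p-formalise-leaf-01` (LEAF PROVER 01, generation 16); own-initiative crew [arith] row «W104 AT PRINT's BONDS-PER-CUBE
LETTER» of `t4/formal/NE1p/LEAVES.md` (INTENT + PROTOTYPE + STAGED in `HOME/CLAIMS.log`; the typer labels it).  ADDITIVE — imports this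
lineage's W104 `Spine/NE1p/DressedComposedChainLetters` (p245093; → the [cite]-tagged `Literature/…/B12TreeDecay` (`K₀`) and
`…/B13Geometry236` (`a236`)) ONLY; THEOREMS ONLY (0 `def`, 0 `def … : Prop`, 0 cite); W104's `uncovered_letter_small_of_hκR` is used BY
NAME, nothing of W104 ∕ S51 ∕ S57 ∕ S62 ∕ W-23c is restated — their clause TEXT is quoted as hypotheses ∕ conclusions of real-arithmetic
lemmas.

WHY THIS FILE.  W104 showed the composed chain's located clause system consistent for every `(L, r₁)` with the bonds-per-cube letter
`b₀` CHOSEN (`b₀ = t = 1`).  At the CARRIERS OF RECORD (this lineage's S62 `DressedSmallFieldComponentInnerCarriersBonds`, the owner's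
N1a PART 3 `DressedSmallFieldRecordLabelsCarriersBonds`) `b₀` is NOT a free letter: the substrate's W-23c `card_bondsOfFineCubes_le_real`
LOCATES it at `b₀ = 4·L^{4m′}` (`L = R.F.L > 11`, `m′` the inner blocking exponent), and the uncovered-cube letter of the fine step reads
`u_k = e^{5R_k}·s·e^{4L^{4m′}·t}`.  Two questions a reader of S62 asks are answered ONCE here, for the clause system itself:
* §1 NECESSITY [arith] — **`inner_rate_window_of_hκR`** (`hκR` with `0 < s`: `e^{5R_k + b₀t} ≤ (R_k − κ₀)∕(64s)`, the right side
  positive), **`bond_letter_le_of_hκR`** (hence `t ≤ (log((R_k − κ₀)∕(64s)) − 5R_k)∕b₀` for `0 < b₀`: with the uncovered-cube letter `s`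
  live, the bond letter is at most logarithmic in the inner rate and INVERSELY proportional to the bonds-per-cube letter),
  **`hκR_iff_bond_letter_le`** (EXACTLY: for `0 < s`, `0 < b₀`, `hκR ↔ κ₀ < R_k ∧ t ≤ (log((R_k − κ₀)∕(64s)) − 5R_k)∕b₀` — the ceiling is
  attained), **`bond_letter_le_carriers`** (the ceiling at `b₀ = 4·L^{4m′}`: at the carriers of record the admissible bond letter shrinks
  like `L^{−4m′}`).
* §2 SUFFICIENCY [arith] — **`letters_exist_of_bondsPerCube`**: for every `3 ≤ L`, `0 ≤ r₁` and EVERY `0 < b₀` the nineteen located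
  clauses of S51 ∕ S62 §1 hold simultaneously at explicit letters with `α₆, s, t, ε, v, A₁, δκ > 0` (W104's witnesses with `t := b₀⁻¹`,
  so `64u_k = 1`; `hrate`, `hRR`, `hrate2`, `h229k`, `h229`, `hsmall` WITH EQUALITY); **`letters_exist_carriers`**: the same in S62 §1's
  LITERAL clause syntax `e^{4·L^{4m′}·t}`, for every `m′`; **`muLetters_exist_of_bondsPerCube`** ∕ **`muLetters_exist_carriers`**: the
  seventeen located clauses of the μ-twin S57 §2 ∕ S62 §2 (amplitude letter `A`, `hsmall : A·e^{5r₁+1}·K₀(64,8)·9·64 ≤ 1`, weight `vW`)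
  likewise, with `A > 0` (`A := A₀ + ϱ·A₁`) — road P1's window `0 < μ₀ < μ₁`, `‖sμ‖ ≤ μ₀` is not a letter of the system and is left free.
WHAT IT SAYS FOR THE WALL (the owner's reading, wall v1.8 of record, T4-DAG v48 §6 NE1 — later DAG versions carry it verbatim; nothing
re-labelled here): the (B5)-KIND half of the composed chain AT THE CARRIERS OF RECORD (print's bonds counted, `b₀ = 4·L^{4m′}` located)
is CONSISTENT AS TYPED at every `(L, m′, r₁)` with live letters, on BOTH pencils — so a failure of NE1′'s small-field bookkeeping on
Bałaban's densities at the carriers must come from (B3-amp) `hAmp` ∕ (B1b) `hadm`, not from the rate arithmetic; and the PRICE of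
print's bonds is typed: the bond letter is `O(L^{−4m′})`.  Whether PRINT's letters ((2.31)–(2.34) p. 18, «|P| ≥ ½M⁻⁴|Z₀∖Y₀|») meet the
located thresholds is NOT asserted — that is the (B5)-KIND reading the wall keeps displayed.  NOTHING of (B3) ∕ (B5) discharged on
Bałaban's (2.14) densities; 0 binders instantiated on Bałaban's densities; no wall item moves; wall v1.8 (T4-DAG v48) — words, not
kind — does NOT move; R-t4r2-Q2 NOT met thereby; NE1′ ⇐ the named binders — ONE label NEW ∕ NOT PRINTED ∕ NOT PROVED; spine PROVED
0∕9; count 9 unchanged.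
PRINTED LOCI (TYPE ∕ CONTEXT only — [Balaban1988RGII] = T. Bałaban, Renormalization group approach to lattice gauge field theories. II,
Commun. Math. Phys. 116 (1988) 1–22, quoted VERBATIM in the imported S51 ∕ S62 ∕ W-23c headers; no new render reading is claimed
here): p. 12 «bonds of P»; p. 18 (2.27), (2.29), (2.31)–(2.34), «one bond in P may connect two cubes in Z₀∖Y₀»; p. 20 (2.37), C₃.
HONEST FRAMING.  Real arithmetic ([arith]) on the crew's DISPLAYED clause shapes; `K₀(64,8)` and `a236` are pv22 ∕ b12's PROVED
constants; `κ₀ = 64·log 162` is the tree's located numeral (N0o), `4·L^{4m′}` the substrate's located bond count (W-23c) — neither a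
numeral of print; print's κ, κ₁, M, (LM)⁴α ≤ 1, C₃ are TYPE ∕ CONTEXT only; ABSOLUTE RULE honoured — nothing internally minted is cited.
Rung (B)+1 on ONE finite four-torus — NOT infinite volume, NOT a mass gap, NOT OS on ℝ⁴, NOT Clay.  HONEST DEPENDENCY: continuum YM on
T⁴ ⇐ BetaPertH ∧ nine spine estimates (0/9 proved); BetaPertH ⇐ (D1) ∧ (D4) ∧ CAP+tail; G-an2-4 gates asym, D1 and NE2/3/4.
-/

noncomputable section

namespace Summit.QuantumFields.BalabanUV.T4Continuum.NE1p.DressedComposedChainLettersBonds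

open Literature.MathematicalPhysics.QuantumFieldTheory.Balaban1983to89.B12TreeDecay (K₀ K₀_pos)
open Literature.MathematicalPhysics.QuantumFieldTheory.Balaban1983to89.B13Geometry236 (a236 a236_pos)
open Summit.QuantumFields.BalabanUV.T4Continuum.NE1p.DressedComposedChainLetters (uncovered_letter_small_of_hκR)

/-! ## §1 NECESSITY: the bond letter pays the bonds-per-cube letter -/

/-- **THE INNER-RATE WINDOW** [arith]: S51 ∕ S62's clause `hκR` with the uncovered-cube letter `s` LIVE gives
`e^{5R_k + b₀t} ≤ (R_k − κ₀)∕(64s)` with a POSITIVE right-hand side (`κ₀ = 64·log 162`; W104's `uncovered_letter_small_of_hκR` BY NAME). -/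
theorem inner_rate_window_of_hκR {Rk s b₀ t : ℝ} (hs : 0 < s)
    (hκR : 64 * Real.log 162 ≤ Rk - 64 * (Real.exp (Rk * 5) * s * Real.exp (b₀ * t))) :
    0 < (Rk - 64 * Real.log 162) / (64 * s) ∧ Real.exp (Rk * 5 + b₀ * t) ≤ (Rk - 64 * Real.log 162) / (64 * s) := by
  have h := uncovered_letter_small_of_hκR hκR
  have h64s : 0 < 64 * s := by positivity
  have key : Real.exp (Rk * 5 + b₀ * t) ≤ (Rk - 64 * Real.log 162) / (64 * s) := by
    rw [le_div_iff₀ h64s, Real.exp_add]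
    calc Real.exp (Rk * 5) * Real.exp (b₀ * t) * (64 * s) = 64 * (Real.exp (Rk * 5) * s * Real.exp (b₀ * t)) := by ring
      _ ≤ Rk - 64 * Real.log 162 := h
  exact ⟨lt_of_lt_of_le (Real.exp_pos _) key, key⟩

/-- **THE BOND LETTER PAYS THE BONDS-PER-CUBE LETTER** [arith]: `hκR` with `0 < s`, `0 < b₀` forces
`t ≤ (log((R_k − κ₀)∕(64s)) − 5R_k)∕b₀` — logarithmic in the inner rate, inversely proportional to `b₀`. -/
theorem bond_letter_le_of_hκR {Rk s b₀ t : ℝ} (hs : 0 < s) (hb₀ : 0 < b₀)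
    (hκR : 64 * Real.log 162 ≤ Rk - 64 * (Real.exp (Rk * 5) * s * Real.exp (b₀ * t))) :
    t ≤ (Real.log ((Rk - 64 * Real.log 162) / (64 * s)) - Rk * 5) / b₀ := by
  obtain ⟨-, key⟩ := inner_rate_window_of_hκR hs hκR
  have hlog : Rk * 5 + b₀ * t ≤ Real.log ((Rk - 64 * Real.log 162) / (64 * s)) := by
    rw [← Real.log_exp (Rk * 5 + b₀ * t)]
    exact Real.log_le_log (Real.exp_pos _) key
  rw [le_div_iff₀ hb₀]
  linarith

/-- **THE CLAUSE `hκR` IS A BOND-LETTER CEILING — EXACTLY** [arith]: for `0 < s`, `0 < b₀`, S51 ∕ S62's `hκR` is EQUIVALENT to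
`κ₀ < R_k ∧ t ≤ (log((R_k − κ₀)∕(64s)) − 5R_k)∕b₀` (the ceiling of `bond_letter_le_of_hκR` is ATTAINED: `hκR` holds with equality at
`t = (log((R_k − κ₀)∕(64s)) − 5R_k)∕b₀`). -/
theorem hκR_iff_bond_letter_le {Rk s b₀ t : ℝ} (hs : 0 < s) (hb₀ : 0 < b₀) :
    64 * Real.log 162 ≤ Rk - 64 * (Real.exp (Rk * 5) * s * Real.exp (b₀ * t)) ↔
      64 * Real.log 162 < Rk ∧ t ≤ (Real.log ((Rk - 64 * Real.log 162) / (64 * s)) - Rk * 5) / b₀ := by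
  have h64s : 0 < 64 * s := by positivity
  constructor
  · intro hκR
    obtain ⟨hpos, -⟩ := inner_rate_window_of_hκR hs hκR
    refine ⟨?_, bond_letter_le_of_hκR hs hb₀ hκR⟩
    have : 0 < Rk - 64 * Real.log 162 := by
      by_contra h
      have : (Rk - 64 * Real.log 162) / (64 * s) ≤ 0 := div_nonpos_of_nonpos_of_nonneg (not_lt.1 h) h64s.le
      linarith
    linarith
  · rintro ⟨hRk, ht⟩
    have hq : 0 < (Rk - 64 * Real.log 162) / (64 * s) := div_pos (by linarith) h64s
    have h1 : Rk * 5 + b₀ * t ≤ Real.log ((Rk - 64 * Real.log 162) / (64 * s)) := by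
      have := (le_div_iff₀ hb₀).1 ht
      linarith
    have h2 : Real.exp (Rk * 5 + b₀ * t) ≤ (Rk - 64 * Real.log 162) / (64 * s) := by
      calc Real.exp (Rk * 5 + b₀ * t) ≤ Real.exp (Real.log ((Rk - 64 * Real.log 162) / (64 * s))) := Real.exp_le_exp.2 h1
        _ = (Rk - 64 * Real.log 162) / (64 * s) := Real.exp_log hq
    rw [le_div_iff₀ h64s, Real.exp_add] at h2
    nlinarith [h2]

/-- **… AT THE CARRIERS OF RECORD** [arith]: with the substrate's located bonds-per-cube letter `b₀ = 4·L^{4m′}` (S62's clause syntax),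
`t ≤ (log((R_k − κ₀)∕(64s)) − 5R_k)∕(4·L^{4m′})` for every `1 ≤ L` and every `m′`. -/
theorem bond_letter_le_carriers {L : ℕ} (hL : 1 ≤ L) (m' : ℕ) {Rk s t : ℝ} (hs : 0 < s)
    (hκR : 64 * Real.log 162 ≤ Rk - 64 * (Real.exp (Rk * 5) * s * Real.exp (4 * (L : ℝ) ^ (4 * m') * t))) :
    t ≤ (Real.log ((Rk - 64 * Real.log 162) / (64 * s)) - Rk * 5) / (4 * (L : ℝ) ^ (4 * m')) :=
  have hL0 : (0 : ℝ) < L := Nat.cast_pos.2 hL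
  bond_letter_le_of_hκR hs (by positivity) hκR

/-! ## §2 SUFFICIENCY: the located system is inhabited with every letter live, for every bonds-per-cube letter -/

/-- **S51 ∕ S62 §1's LETTER SYSTEM IS CONSISTENT AT EVERY BONDS-PER-CUBE LETTER** [arith]: for every `3 ≤ L`, `0 ≤ r₁` and every
`0 < b₀` there are letters `δ κ α₆ R_k s t ε r R v Rkp A₀ A₁ ϱ` with `α₆, s, t, ε, v, A₁, δκ > 0` meeting ALL nineteen located clauses
`hA₀`, `hA₁`, `hr₁`, `hrate`, `hsmall`, `hα₆`, `hκk`, `h229k`, `hs0`, `hs1`, `ht`, `hε`, `hv`, `hκR`, `hrate2`, `hκ`, `h229`, `hRR`, `hϱ`,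
`hϱA` VERBATIM in their located syntax (W104's closed-form witnesses with `t := b₀⁻¹`, so `64·u_k = 1`; `hrate`, `hRR`, `hrate2`,
`h229k`, `h229`, `hsmall` WITH EQUALITY). -/
theorem letters_exist_of_bondsPerCube {L : ℕ} (hL : 3 ≤ L) {r₁ : ℝ} (hr₁ : 0 ≤ r₁) {b₀ : ℝ} (hb₀ : 0 < b₀) :
    ∃ δ κ α₆ Rk s t ε r R v Rkp A₀ A₁ ϱ : ℝ,
      (0 < α₆ ∧ 0 < s ∧ 0 < t ∧ 0 < ε ∧ 0 < v ∧ 0 < A₁ ∧ 0 < δ * κ) ∧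
      0 ≤ A₀ ∧ 0 ≤ A₁ ∧ 0 ≤ r₁ ∧
      r₁ + 2 * (64 * Real.log 162) + 2 ≤ Rkp ∧
      (A₀ + ϱ * A₁) * Real.exp (5 * r₁ + 1) * K₀ 64 8 * 9 * 64 ≤ 1 ∧
      0 ≤ α₆ ∧ 64 * Real.log 162 + 1 ≤ δ * κ ∧ Real.exp 1 * K₀ 64 8 * 64 * α₆ ≤ 1 ∧
      0 ≤ s ∧ s ≤ 1 ∧ 0 ≤ t ∧ 0 ≤ ε ∧ 0 ≤ v ∧
      64 * Real.log 162 ≤ Rk - 64 * (Real.exp (Rk * 5) * s * Real.exp (b₀ * t)) ∧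
      r + R ≤ (Rk - 64 * (Real.exp (Rk * 5) * s * Real.exp (b₀ * t)) - 64 * Real.log 162) * ((L : ℝ) / a236 L) ∧
      64 * Real.log 162 + 1 ≤ r ∧
      Real.exp 1 * K₀ 64 8 * 64 *
        (ε * Real.exp (64 * (Real.exp (Rk * 5) * s * Real.exp (b₀ * t)) - 5 * Rk) * ((3 : ℝ) ^ 4 * (L : ℝ) ^ 4) * K₀ 64 8 *
          Real.exp (5 * R)) ≤ 1 ∧
      Rkp ≤ R - 64 * (v * Real.exp (R * 5)) ∧
      2 ≤ ϱ ∧ A₀ ≤ ϱ * A₁ := by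
  -- located constants
  have hlog : 0 < Real.log 162 := Real.log_pos (by norm_num)
  have hK := K₀_pos (64 : ℝ) 8
  have he := Real.exp_pos (1 : ℝ)
  have hLr : (3 : ℝ) ≤ L := by exact_mod_cast hL
  have hℓ : 0 < (L : ℝ) / a236 L := div_pos (by linarith) (a236_pos (by linarith))
  -- the witnesses (W104's, with the bond letter `t := b₀⁻¹`)
  set κ₀ : ℝ := 64 * Real.log 162 with hκ₀
  set r : ℝ := κ₀ + 1 with hr
  set R : ℝ := r₁ + 2 * κ₀ + 3 with hR
  set Rkp : ℝ := r₁ + 2 * κ₀ + 2 with hRkp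
  set v : ℝ := Real.exp (-(R * 5)) / 64 with hv
  set Rk : ℝ := κ₀ + 1 + (r + R) / ((L : ℝ) / a236 L) with hRk
  set s : ℝ := Real.exp (-(Rk * 5)) * (Real.exp (-1) / 64) with hs
  set α₆ : ℝ := (Real.exp 1 * K₀ 64 8 * 64)⁻¹ with hα₆
  set A₁ : ℝ := (2 * Real.exp (5 * r₁ + 1) * K₀ 64 8 * 9 * 64)⁻¹ with hA₁
  set ε : ℝ := (Real.exp 1 * K₀ 64 8 * 64 *
    (Real.exp (64 * (Real.exp (Rk * 5) * s * Real.exp (b₀ * b₀⁻¹)) - 5 * Rk) * ((3 : ℝ) ^ 4 * (L : ℝ) ^ 4) * K₀ 64 8 *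
      Real.exp (5 * R)))⁻¹ with hε
  have hRk0 : 0 < Rk := by
    have : 0 ≤ (r + R) / ((L : ℝ) / a236 L) := div_nonneg (by positivity) hℓ.le
    positivity
  have hbt : b₀ * b₀⁻¹ = 1 := mul_inv_cancel₀ hb₀.ne'
  -- the uncovered-cube letter of the fine step: `64·u_k = 1`
  have hu : Real.exp (Rk * 5) * s * Real.exp (b₀ * b₀⁻¹) = 1 / 64 := by
    rw [hbt, hs, Real.exp_neg, Real.exp_neg]
    field_simp
  have hvR : v * Real.exp (R * 5) = 1 / 64 := by
    rw [hv, Real.exp_neg]; field_simp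
  refine ⟨1, κ₀ + 1, α₆, Rk, s, b₀⁻¹, ε, r, R, v, Rkp, 0, A₁, 2, ⟨?_, ?_, ?_, ?_, ?_, ?_, ?_⟩, le_rfl, ?_, hr₁,
    ?_, ?_, ?_, ?_, ?_, ?_, ?_, ?_, ?_, ?_, ?_, ?_, ?_, ?_, ?_, le_rfl, ?_⟩
  · positivity
  · positivity
  · positivity
  · positivity
  · positivity
  · positivity
  · rw [one_mul]; positivity
  · positivity
  · -- hrate WITH EQUALITY
    rw [hRkp]
  · -- hsmall WITH EQUALITY
    rw [hA₁, zero_add]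
    have : 0 < 2 * Real.exp (5 * r₁ + 1) * K₀ 64 8 * 9 * 64 := by positivity
    rw [show (2 : ℝ) * (2 * Real.exp (5 * r₁ + 1) * K₀ 64 8 * 9 * 64)⁻¹ * Real.exp (5 * r₁ + 1) * K₀ 64 8 * 9 * 64 =
      (2 * Real.exp (5 * r₁ + 1) * K₀ 64 8 * 9 * 64) * (2 * Real.exp (5 * r₁ + 1) * K₀ 64 8 * 9 * 64)⁻¹ by ring,
      mul_inv_cancel₀ this.ne']
  · positivity
  · rw [one_mul]
  · -- h229k WITH EQUALITY
    rw [hα₆, mul_inv_cancel₀ (by positivity : Real.exp 1 * K₀ 64 8 * 64 ≠ 0)]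
  · positivity
  · -- s ≤ 1
    rw [hs, Real.exp_neg, Real.exp_neg]
    have h5 : 1 ≤ Real.exp (Rk * 5) := Real.one_le_exp (by positivity)
    have h1 : 1 ≤ Real.exp 1 := Real.one_le_exp (by norm_num)
    calc (Real.exp (Rk * 5))⁻¹ * ((Real.exp 1)⁻¹ / 64) ≤ 1 * (1 / 64) := by
          gcongr
          · exact inv_le_one_of_one_le₀ h5
          · exact inv_le_one_of_one_le₀ h1
      _ ≤ 1 := by norm_num
  · positivity
  · positivity
  · positivity
  · -- hκR: `κ₀ ≤ R_k − 1`
    rw [hu, hRk]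
    have : 0 ≤ (r + R) / ((L : ℝ) / a236 L) := div_nonneg (by positivity) hℓ.le
    linarith
  · -- hrate2 WITH EQUALITY
    rw [hu]
    have : (Rk - 64 * (1 / 64) - 64 * Real.log 162) = (r + R) / ((L : ℝ) / a236 L) := by rw [hRk]; ring
    rw [this, div_mul_cancel₀ _ hℓ.ne']
  · rw [hr]
  · -- h229 WITH EQUALITY
    have hpos : 0 < Real.exp 1 * K₀ 64 8 * 64 *
        (Real.exp (64 * (Real.exp (Rk * 5) * s * Real.exp (b₀ * b₀⁻¹)) - 5 * Rk) * ((3 : ℝ) ^ 4 * (L : ℝ) ^ 4) * K₀ 64 8 *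
          Real.exp (5 * R)) := by positivity
    rw [show Real.exp 1 * K₀ 64 8 * 64 *
        (ε * Real.exp (64 * (Real.exp (Rk * 5) * s * Real.exp (b₀ * b₀⁻¹)) - 5 * Rk) * ((3 : ℝ) ^ 4 * (L : ℝ) ^ 4) * K₀ 64 8 *
          Real.exp (5 * R)) =
      ε * (Real.exp 1 * K₀ 64 8 * 64 *
        (Real.exp (64 * (Real.exp (Rk * 5) * s * Real.exp (b₀ * b₀⁻¹)) - 5 * Rk) * ((3 : ℝ) ^ 4 * (L : ℝ) ^ 4) * K₀ 64 8 *
          Real.exp (5 * R))) by ring, hε, inv_mul_cancel₀ hpos.ne']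
  · -- hRR WITH EQUALITY
    rw [hvR, hRkp, hR]; linarith
  · positivity

/-- **… AT THE CARRIERS OF RECORD** [arith]: the same nineteen clauses in S62 §1's LITERAL syntax — the substrate's located
bonds-per-cube letter `b₀ = 4·L^{4m′}` inside `u_k = e^{5R_k}·s·e^{4L^{4m′}·t}` — are inhabited with every letter live, for every
`3 ≤ L`, every inner blocking exponent `m′` and every `0 ≤ r₁` (`letters_exist_of_bondsPerCube` at `b₀ := 4·L^{4m′} > 0`). -/
theorem letters_exist_carriers {L : ℕ} (hL : 3 ≤ L) (m' : ℕ) {r₁ : ℝ} (hr₁ : 0 ≤ r₁) :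
    ∃ δ κ α₆ Rk s t ε r R v Rkp A₀ A₁ ϱ : ℝ,
      (0 < α₆ ∧ 0 < s ∧ 0 < t ∧ 0 < ε ∧ 0 < v ∧ 0 < A₁ ∧ 0 < δ * κ) ∧
      0 ≤ A₀ ∧ 0 ≤ A₁ ∧ 0 ≤ r₁ ∧
      r₁ + 2 * (64 * Real.log 162) + 2 ≤ Rkp ∧
      (A₀ + ϱ * A₁) * Real.exp (5 * r₁ + 1) * K₀ 64 8 * 9 * 64 ≤ 1 ∧
      0 ≤ α₆ ∧ 64 * Real.log 162 + 1 ≤ δ * κ ∧ Real.exp 1 * K₀ 64 8 * 64 * α₆ ≤ 1 ∧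
      0 ≤ s ∧ s ≤ 1 ∧ 0 ≤ t ∧ 0 ≤ ε ∧ 0 ≤ v ∧
      64 * Real.log 162 ≤ Rk - 64 * (Real.exp (Rk * 5) * s * Real.exp (4 * (L : ℝ) ^ (4 * m') * t)) ∧
      r + R ≤ (Rk - 64 * (Real.exp (Rk * 5) * s * Real.exp (4 * (L : ℝ) ^ (4 * m') * t)) - 64 * Real.log 162) *
        ((L : ℝ) / a236 L) ∧
      64 * Real.log 162 + 1 ≤ r ∧
      Real.exp 1 * K₀ 64 8 * 64 *
        (ε * Real.exp (64 * (Real.exp (Rk * 5) * s * Real.exp (4 * (L : ℝ) ^ (4 * m') * t)) - 5 * Rk) *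
          ((3 : ℝ) ^ 4 * (L : ℝ) ^ 4) * K₀ 64 8 * Real.exp (5 * R)) ≤ 1 ∧
      Rkp ≤ R - 64 * (v * Real.exp (R * 5)) ∧
      2 ≤ ϱ ∧ A₀ ≤ ϱ * A₁ :=
  have hL0 : (0 : ℝ) < L := Nat.cast_pos.2 (by omega)
  letters_exist_of_bondsPerCube hL hr₁ (b₀ := 4 * (L : ℝ) ^ (4 * m')) (by positivity)

/-- **THE μ-TWIN's LETTER SYSTEM IS CONSISTENT AT EVERY BONDS-PER-CUBE LETTER** [arith]: for every `3 ≤ L`, `0 ≤ r₁` and every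
`0 < b₀` the seventeen located clauses of S57 §2 ∕ S62 §2 — `hA`, `hr₁`, `hrate`, `hsmall : A·e^{5r₁+1}·K₀(64,8)·9·64 ≤ 1`, `hα₆`, `hκk`,
`h229k`, `hs0`, `hs1`, `ht`, `hε`, `hvW`, `hκR`, `hrate2`, `hκ`, `h229`, `hRR` — hold simultaneously at letters with
`α₆, s, t, ε, vW, A, δκ > 0` (`letters_exist_of_bondsPerCube` with `A := A₀ + ϱ·A₁`).  Road P1's source window `0 < μ₀ < μ₁`, `‖sμ‖ ≤ μ₀`
(`h0`∕`h01`∕`hμ`) is not a letter of the system and stays free. -/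
theorem muLetters_exist_of_bondsPerCube {L : ℕ} (hL : 3 ≤ L) {r₁ : ℝ} (hr₁ : 0 ≤ r₁) {b₀ : ℝ} (hb₀ : 0 < b₀) :
    ∃ δ κ α₆ Rk s t ε r R vW Rkp A : ℝ,
      (0 < α₆ ∧ 0 < s ∧ 0 < t ∧ 0 < ε ∧ 0 < vW ∧ 0 < A ∧ 0 < δ * κ) ∧
      0 ≤ A ∧ 0 ≤ r₁ ∧
      r₁ + 2 * (64 * Real.log 162) + 2 ≤ Rkp ∧
      A * Real.exp (5 * r₁ + 1) * K₀ 64 8 * 9 * 64 ≤ 1 ∧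
      0 ≤ α₆ ∧ 64 * Real.log 162 + 1 ≤ δ * κ ∧ Real.exp 1 * K₀ 64 8 * 64 * α₆ ≤ 1 ∧
      0 ≤ s ∧ s ≤ 1 ∧ 0 ≤ t ∧ 0 ≤ ε ∧ 0 ≤ vW ∧
      64 * Real.log 162 ≤ Rk - 64 * (Real.exp (Rk * 5) * s * Real.exp (b₀ * t)) ∧
      r + R ≤ (Rk - 64 * (Real.exp (Rk * 5) * s * Real.exp (b₀ * t)) - 64 * Real.log 162) * ((L : ℝ) / a236 L) ∧
      64 * Real.log 162 + 1 ≤ r ∧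
      Real.exp 1 * K₀ 64 8 * 64 *
        (ε * Real.exp (64 * (Real.exp (Rk * 5) * s * Real.exp (b₀ * t)) - 5 * Rk) * ((3 : ℝ) ^ 4 * (L : ℝ) ^ 4) * K₀ 64 8 *
          Real.exp (5 * R)) ≤ 1 ∧
      Rkp ≤ R - 64 * (vW * Real.exp (R * 5)) := by
  obtain ⟨δ, κ, α₆, Rk, s, t, ε, r, R, v, Rkp, A₀, A₁, ϱ, ⟨hα₆0, hs0', ht0, hε0, hv0, hA₁0, hδκ⟩, hA₀, hA₁, -, hrate, hsmall, hα₆,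
    hκk, h229k, hs0, hs1, ht, hε, hv, hκR, hrate2, hκ, h229, hRR, hϱ, -⟩ := letters_exist_of_bondsPerCube hL hr₁ hb₀
  have hϱA₁ : 0 < ϱ * A₁ := mul_pos (by linarith) hA₁0
  exact ⟨δ, κ, α₆, Rk, s, t, ε, r, R, v, Rkp, A₀ + ϱ * A₁, ⟨hα₆0, hs0', ht0, hε0, hv0, by linarith, hδκ⟩, by linarith, hr₁, hrate,
    hsmall, hα₆, hκk, h229k, hs0, hs1, ht, hε, hv, hκR, hrate2, hκ, h229, hRR⟩

/-- **… AT THE CARRIERS OF RECORD** [arith]: the μ-twin's seventeen clauses in S62 §2's LITERAL syntax (`b₀ = 4·L^{4m′}`), inhabited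
with every letter live for every `3 ≤ L`, every `m′` and every `0 ≤ r₁`. -/
theorem muLetters_exist_carriers {L : ℕ} (hL : 3 ≤ L) (m' : ℕ) {r₁ : ℝ} (hr₁ : 0 ≤ r₁) :
    ∃ δ κ α₆ Rk s t ε r R vW Rkp A : ℝ,
      (0 < α₆ ∧ 0 < s ∧ 0 < t ∧ 0 < ε ∧ 0 < vW ∧ 0 < A ∧ 0 < δ * κ) ∧
      0 ≤ A ∧ 0 ≤ r₁ ∧
      r₁ + 2 * (64 * Real.log 162) + 2 ≤ Rkp ∧
      A * Real.exp (5 * r₁ + 1) * K₀ 64 8 * 9 * 64 ≤ 1 ∧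
      0 ≤ α₆ ∧ 64 * Real.log 162 + 1 ≤ δ * κ ∧ Real.exp 1 * K₀ 64 8 * 64 * α₆ ≤ 1 ∧
      0 ≤ s ∧ s ≤ 1 ∧ 0 ≤ t ∧ 0 ≤ ε ∧ 0 ≤ vW ∧
      64 * Real.log 162 ≤ Rk - 64 * (Real.exp (Rk * 5) * s * Real.exp (4 * (L : ℝ) ^ (4 * m') * t)) ∧
      r + R ≤ (Rk - 64 * (Real.exp (Rk * 5) * s * Real.exp (4 * (L : ℝ) ^ (4 * m') * t)) - 64 * Real.log 162) *
        ((L : ℝ) / a236 L) ∧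
      64 * Real.log 162 + 1 ≤ r ∧
      Real.exp 1 * K₀ 64 8 * 64 *
        (ε * Real.exp (64 * (Real.exp (Rk * 5) * s * Real.exp (4 * (L : ℝ) ^ (4 * m') * t)) - 5 * Rk) *
          ((3 : ℝ) ^ 4 * (L : ℝ) ^ 4) * K₀ 64 8 * Real.exp (5 * R)) ≤ 1 ∧
      Rkp ≤ R - 64 * (vW * Real.exp (R * 5)) :=
  have hL0 : (0 : ℝ) < L := Nat.cast_pos.2 (by omega)
  muLetters_exist_of_bondsPerCube hL hr₁ (b₀ := 4 * (L : ℝ) ^ (4 * m')) (by positivity)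

/-- Closing decided instance [arith]: the carriers' clause system of S62 §1 at Bałaban's smallest admissible blocking factor of the
family (`L = 12 > 11`, TYPE only), inner exponent `m′ = 1`, outer rate `r₁ = 0` — inhabited. -/
example : ∃ δ κ α₆ Rk s t ε r R v Rkp A₀ A₁ ϱ : ℝ,
      (0 < α₆ ∧ 0 < s ∧ 0 < t ∧ 0 < ε ∧ 0 < v ∧ 0 < A₁ ∧ 0 < δ * κ) ∧
      0 ≤ A₀ ∧ 0 ≤ A₁ ∧ (0 : ℝ) ≤ 0 ∧
      0 + 2 * (64 * Real.log 162) + 2 ≤ Rkp ∧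
      (A₀ + ϱ * A₁) * Real.exp (5 * 0 + 1) * K₀ 64 8 * 9 * 64 ≤ 1 ∧
      0 ≤ α₆ ∧ 64 * Real.log 162 + 1 ≤ δ * κ ∧ Real.exp 1 * K₀ 64 8 * 64 * α₆ ≤ 1 ∧
      0 ≤ s ∧ s ≤ 1 ∧ 0 ≤ t ∧ 0 ≤ ε ∧ 0 ≤ v ∧
      64 * Real.log 162 ≤ Rk - 64 * (Real.exp (Rk * 5) * s * Real.exp (4 * ((12 : ℕ) : ℝ) ^ (4 * 1) * t)) ∧
      r + R ≤ (Rk - 64 * (Real.exp (Rk * 5) * s * Real.exp (4 * ((12 : ℕ) : ℝ) ^ (4 * 1) * t)) - 64 * Real.log 162) *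
        (((12 : ℕ) : ℝ) / a236 ((12 : ℕ) : ℝ)) ∧
      64 * Real.log 162 + 1 ≤ r ∧
      Real.exp 1 * K₀ 64 8 * 64 *
        (ε * Real.exp (64 * (Real.exp (Rk * 5) * s * Real.exp (4 * ((12 : ℕ) : ℝ) ^ (4 * 1) * t)) - 5 * Rk) *
          ((3 : ℝ) ^ 4 * ((12 : ℕ) : ℝ) ^ 4) * K₀ 64 8 * Real.exp (5 * R)) ≤ 1 ∧
      Rkp ≤ R - 64 * (v * Real.exp (R * 5)) ∧
      2 ≤ ϱ ∧ A₀ ≤ ϱ * A₁ :=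
  letters_exist_carriers (L := 12) (by norm_num) 1 le_rfl

end Summit.QuantumFields.BalabanUV.T4Continuum.NE1p.DressedComposedChainLettersBonds

end
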